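import Mathlib.Analysis.InnerProductSpace.PiL2
import Mathlib.Analysis.InnerProductSpace.Symmetric
import HarnessLib

/-!
# Lipschitz functions of symmetric operators are Hilbert–Schmidt–Lipschitz (Kittaneh's inequality, finite-dimensional real form)

Source: F. Kittaneh, *On Lipschitz functions of normal operators*, Proc. Amer. Math. Soc. **94** (1985) 416–418, Corollary 2 (with `X = I`):
for normal operators `N, M` and a `k`-Lipschitz function `f` on `σ(N) ∪ σ(M)`, `‖f(N) − f(M)‖₂ ≤ k ‖N − M‖₂` in the Hilbert–Schmidt norm
(proof on p. 416: the `(i,j)` matrix entry of `f(D)X − Xf(D')` in eigenbases is `(f(λᵢ) − f(λ'ⱼ))xᵢⱼ`).  (Also R. Bhatia,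
*Matrix Analysis*, GTM 169, §VII and §X, for the matrix case.)

We record the finite-dimensional REAL SYMMETRIC case in FRAME FORM, which needs no functional-calculus API: a symmetric `A` with an
orthonormal eigenframe `A uᵢ = αᵢ uᵢ`, any `B` with an orthonormal eigenframe `B vⱼ = βⱼ vⱼ`, and operators `HA` (symmetric), `HB` acting on
these frames as `h`: `HA uᵢ = h(αᵢ) uᵢ`, `HB vⱼ = h(βⱼ) vⱼ`.  The proof is the classical double-Parseval computation: the matrix element
`⟨uᵢ, (HA − HB) vⱼ⟩ = (h(αᵢ) − h(βⱼ))⟨uᵢ, vⱼ⟩` is dominated termwise by `L |αᵢ − βⱼ| |⟨uᵢ, vⱼ⟩| = L |⟨uᵢ, (A − B) vⱼ⟩|`.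

* `sum_sum_inner_sq_eq` — the Hilbert–Schmidt sum in two frames: `Σᵢⱼ ⟨uᵢ, M vⱼ⟩² = Σⱼ ‖M vⱼ‖²`;
* `abs_inner_le_sqrt_hsSum` — `|⟨x, M y⟩| ≤ √(Σᵢⱼ ⟨uᵢ, M vⱼ⟩²) ‖x‖ ‖y‖` (operator norm ≤ Hilbert–Schmidt norm);
* ★ `hsSum_sub_le` — **Kittaneh**: `Σᵢⱼ ⟨uᵢ, (HA − HB) vⱼ⟩² ≤ L² Σᵢⱼ ⟨uᵢ, (A − B) vⱼ⟩²`;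
* ★ `abs_inner_sub_le` — the usable form `|⟨x, (HA − HB) y⟩| ≤ L √(Σⱼ ‖(A − B) vⱼ‖²) ‖x‖ ‖y‖`, and `abs_inner_sub_le_of_norm_le` —
  `≤ L √|κ| δ ‖x‖‖y‖` whenever `‖(A − B) z‖ ≤ δ‖z‖`.

No definitions, no named facts, 0 sorry.
-- TODO(general form): normal operators on a complex Hilbert space and the commutator version `‖f(N)X − Xf(M)‖₂ ≤ k‖NX − XM‖₂` (Kittaneh, Cor. 2).
-/

noncomputable section

open Real
open scoped RealInnerProductSpace

namespace Literature.Analysis.OperatorTheory.SymmetricLipschitz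

variable {E : Type*} [NormedAddCommGroup E] [InnerProductSpace ℝ E]
variable {ι κ : Type*} [Fintype ι] [Fintype κ]

/-! ## §1 Hilbert–Schmidt sums in two orthonormal frames -/

/-- The Hilbert–Schmidt sum of `M` in two orthonormal frames: `Σᵢ Σⱼ ⟨uᵢ, M vⱼ⟩² = Σⱼ ‖M vⱼ‖²` (Parseval in `u`). [cite: Kittaneh1985, Cor. 2] -/
theorem sum_sum_inner_sq_eq (u : OrthonormalBasis ι ℝ E) (v : OrthonormalBasis κ ℝ E) (M : E →ₗ[ℝ] E) :
    ∑ i, ∑ j, ⟪u i, M (v j)⟫ ^ 2 = ∑ j, ‖M (v j)‖ ^ 2 := by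
  rw [Finset.sum_comm]
  exact Finset.sum_congr rfl fun j _ => u.sum_sq_inner_right _

/-- The matrix element in two frames: `⟨x, M y⟩ = Σᵢ Σⱼ ⟨x, uᵢ⟩ ⟨vⱼ, y⟩ ⟨uᵢ, M vⱼ⟩` (helper). [folklore] -/
private theorem inner_apply_eq_sum_sum (u : OrthonormalBasis ι ℝ E) (v : OrthonormalBasis κ ℝ E) (M : E →ₗ[ℝ] E) (x y : E) :
    ⟪x, M y⟫ = ∑ i, ∑ j, ⟪x, u i⟫ * ⟪v j, y⟫ * ⟪u i, M (v j)⟫ := by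
  conv_lhs => rw [← v.sum_repr' y, map_sum, inner_sum]
  rw [Finset.sum_comm]
  refine Finset.sum_congr rfl fun j _ => ?_
  rw [map_smul, inner_smul_right, ← u.sum_inner_mul_inner x (M (v j)), Finset.mul_sum]
  exact Finset.sum_congr rfl fun i _ => by ring

/-- ★ **Operator norm ≤ Hilbert–Schmidt norm**: `|⟨x, M y⟩| ≤ √(Σᵢⱼ ⟨uᵢ, M vⱼ⟩²) · ‖x‖ · ‖y‖`. [cite: Kittaneh1985, Cor. 2] -/
theorem abs_inner_le_sqrt_hsSum (u : OrthonormalBasis ι ℝ E) (v : OrthonormalBasis κ ℝ E) (M : E →ₗ[ℝ] E) (x y : E) :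
    |⟪x, M y⟫| ≤ Real.sqrt (∑ i, ∑ j, ⟪u i, M (v j)⟫ ^ 2) * ‖x‖ * ‖y‖ := by
  rw [inner_apply_eq_sum_sum u v M x y]
  -- Cauchy–Schwarz on `ι × κ`
  have hcs := Finset.sum_mul_sq_le_sq_mul_sq (Finset.univ : Finset (ι × κ)) (fun p => ⟪u p.1, M (v p.2)⟫)
    (fun p => ⟪x, u p.1⟫ * ⟪v p.2, y⟫)
  have e1 : ∑ p : ι × κ, ⟪u p.1, M (v p.2)⟫ * (⟪x, u p.1⟫ * ⟪v p.2, y⟫) = ∑ i, ∑ j, ⟪x, u i⟫ * ⟪v j, y⟫ * ⟪u i, M (v j)⟫ := by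
    rw [Fintype.sum_prod_type]; exact Finset.sum_congr rfl fun i _ => Finset.sum_congr rfl fun j _ => by ring
  have e2 : ∑ p : ι × κ, ⟪u p.1, M (v p.2)⟫ ^ 2 = ∑ i, ∑ j, ⟪u i, M (v j)⟫ ^ 2 := by rw [Fintype.sum_prod_type]
  have e3 : ∑ p : ι × κ, (⟪x, u p.1⟫ * ⟪v p.2, y⟫) ^ 2 = ‖x‖ ^ 2 * ‖y‖ ^ 2 := by
    rw [Fintype.sum_prod_type]
    simp_rw [mul_pow]
    rw [← Finset.sum_mul_sum, u.sum_sq_inner_left, v.sum_sq_inner_right]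
  rw [e1, e2, e3] at hcs
  have hS : 0 ≤ ∑ i, ∑ j, ⟪u i, M (v j)⟫ ^ 2 := Finset.sum_nonneg fun i _ => Finset.sum_nonneg fun j _ => sq_nonneg _
  have hrhs : 0 ≤ Real.sqrt (∑ i, ∑ j, ⟪u i, M (v j)⟫ ^ 2) * ‖x‖ * ‖y‖ := by positivity
  rw [← Real.sqrt_sq_eq_abs, ← Real.sqrt_sq hrhs]
  refine Real.sqrt_le_sqrt (hcs.trans_eq ?_)
  rw [mul_pow, mul_pow, Real.sq_sqrt hS, mul_assoc]

/-- A bound `‖M z‖ ≤ C‖z‖` controls the Hilbert–Schmidt sum by `|κ|·C²` (helper). [folklore] -/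
private theorem sum_norm_sq_le (v : OrthonormalBasis κ ℝ E) {M : E →ₗ[ℝ] E} {C : ℝ} (hM : ∀ z, ‖M z‖ ≤ C * ‖z‖) :
    ∑ j, ‖M (v j)‖ ^ 2 ≤ Fintype.card κ * C ^ 2 := by
  have hC : ∀ j, ‖M (v j)‖ ^ 2 ≤ C ^ 2 := fun j => by
    have h := hM (v j)
    rw [v.orthonormal.1 j, mul_one] at h
    exact pow_le_pow_left₀ (norm_nonneg _) h 2
  calc ∑ j, ‖M (v j)‖ ^ 2 ≤ ∑ _j : κ, C ^ 2 := Finset.sum_le_sum fun j _ => hC j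
    _ = Fintype.card κ * C ^ 2 := by simp

/-- `√(Σⱼ ‖M vⱼ‖²) ≤ √|κ| · C` when `‖M z‖ ≤ C‖z‖` with `C ≥ 0` (helper). [folklore] -/
private theorem sqrt_sum_norm_sq_le (v : OrthonormalBasis κ ℝ E) {M : E →ₗ[ℝ] E} {C : ℝ} (hC : 0 ≤ C) (hM : ∀ z, ‖M z‖ ≤ C * ‖z‖) :
    Real.sqrt (∑ j, ‖M (v j)‖ ^ 2) ≤ Real.sqrt (Fintype.card κ) * C := by
  rw [← Real.sqrt_sq hC, ← Real.sqrt_mul (Nat.cast_nonneg _)]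
  exact Real.sqrt_le_sqrt (sum_norm_sq_le v hM)

/-! ## §2 Matrix elements of operators diagonal in the two frames -/

section Frames

variable {A B HA HB : E →ₗ[ℝ] E} {u : OrthonormalBasis ι ℝ E} {v : OrthonormalBasis κ ℝ E} {α : ι → ℝ} {β : κ → ℝ} {h : ℝ → ℝ}

/-- `⟨uᵢ, (A − B) vⱼ⟩ = (αᵢ − βⱼ) ⟨uᵢ, vⱼ⟩` for `A` symmetric diagonal in `u` and `B` diagonal in `v`. [cite: Kittaneh1985, Cor. 2] -/
theorem inner_sub_apply_eq (hA : A.IsSymmetric) (hu : ∀ i, A (u i) = α i • u i) (hv : ∀ j, B (v j) = β j • v j) (i : ι) (j : κ) :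
    ⟪u i, (A - B) (v j)⟫ = (α i - β j) * ⟪u i, v j⟫ := by
  rw [LinearMap.sub_apply, inner_sub_right, ← hA (u i) (v j), hu i, hv j, inner_smul_left, inner_smul_right]
  simp only [conj_trivial]
  ring

/-- ★ **KITTANEH'S INEQUALITY (finite-dimensional real symmetric form).**  If `A` (symmetric) has the orthonormal eigenframe `A uᵢ = αᵢ uᵢ`,
`B` the orthonormal eigenframe `B vⱼ = βⱼ vⱼ`, `HA` (symmetric) and `HB` act on them as `h` (`HA uᵢ = h(αᵢ)uᵢ`, `HB vⱼ = h(βⱼ)vⱼ`), and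
`|h s − h t| ≤ L|s − t|`, then the Hilbert–Schmidt sums satisfy `Σᵢⱼ ⟨uᵢ,(HA − HB)vⱼ⟩² ≤ L² Σᵢⱼ ⟨uᵢ,(A − B)vⱼ⟩²`. [cite: Kittaneh1985, Cor. 2] -/
theorem hsSum_sub_le (hA : A.IsSymmetric) (hHA : HA.IsSymmetric) (hu : ∀ i, A (u i) = α i • u i) (hv : ∀ j, B (v j) = β j • v j)
    (hHu : ∀ i, HA (u i) = h (α i) • u i) (hHv : ∀ j, HB (v j) = h (β j) • v j) {L : ℝ} (hh : ∀ s t, |h s - h t| ≤ L * |s - t|) :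
    ∑ i, ∑ j, ⟪u i, (HA - HB) (v j)⟫ ^ 2 ≤ L ^ 2 * ∑ i, ∑ j, ⟪u i, (A - B) (v j)⟫ ^ 2 := by
  rw [Finset.mul_sum]
  refine Finset.sum_le_sum fun i _ => ?_
  rw [Finset.mul_sum]
  refine Finset.sum_le_sum fun j _ => ?_
  rw [inner_sub_apply_eq hHA hHu hHv i j, inner_sub_apply_eq hA hu hv i j, mul_pow, mul_pow, ← mul_assoc]
  refine mul_le_mul_of_nonneg_right ?_ (sq_nonneg _)
  have h1 := hh (α i) (β j)
  have hL : 0 ≤ L * |α i - β j| := (abs_nonneg _).trans h1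
  calc (h (α i) - h (β j)) ^ 2 = |h (α i) - h (β j)| ^ 2 := (sq_abs _).symm
    _ ≤ (L * |α i - β j|) ^ 2 := pow_le_pow_left₀ (abs_nonneg _) h1 2
    _ = L ^ 2 * (α i - β j) ^ 2 := by rw [mul_pow, sq_abs]

/-- ★ **USABLE FORM**: under the hypotheses of `hsSum_sub_le` with `L ≥ 0`, for all `x, y`:
`|⟨x, (HA − HB) y⟩| ≤ L · √(Σⱼ ‖(A − B) vⱼ‖²) · ‖x‖ · ‖y‖`. [cite: Kittaneh1985, Cor. 2] -/
theorem abs_inner_sub_le (hA : A.IsSymmetric) (hHA : HA.IsSymmetric) (hu : ∀ i, A (u i) = α i • u i) (hv : ∀ j, B (v j) = β j • v j)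
    (hHu : ∀ i, HA (u i) = h (α i) • u i) (hHv : ∀ j, HB (v j) = h (β j) • v j) {L : ℝ} (hL : 0 ≤ L)
    (hh : ∀ s t, |h s - h t| ≤ L * |s - t|) (x y : E) :
    |⟪x, (HA - HB) y⟫| ≤ L * Real.sqrt (∑ j, ‖(A - B) (v j)‖ ^ 2) * ‖x‖ * ‖y‖ := by
  have h1 := abs_inner_le_sqrt_hsSum u v (HA - HB) x y
  have h2 : Real.sqrt (∑ i, ∑ j, ⟪u i, (HA - HB) (v j)⟫ ^ 2) ≤ L * Real.sqrt (∑ j, ‖(A - B) (v j)‖ ^ 2) := by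
    rw [← sum_sum_inner_sq_eq u v (A - B), ← Real.sqrt_sq hL, ← Real.sqrt_mul (sq_nonneg L)]
    exact Real.sqrt_le_sqrt (hsSum_sub_le hA hHA hu hv hHu hHv hh)
  exact h1.trans (mul_le_mul_of_nonneg_right (mul_le_mul_of_nonneg_right h2 (norm_nonneg _)) (norm_nonneg _))

/-- The same with an operator-type bound `‖(A − B) z‖ ≤ δ‖z‖` on the right: `|⟨x, (HA − HB) y⟩| ≤ L · √|κ| · δ · ‖x‖ · ‖y‖`.
[cite: Kittaneh1985, Cor. 2] -/
theorem abs_inner_sub_le_of_norm_le (hA : A.IsSymmetric) (hHA : HA.IsSymmetric) (hu : ∀ i, A (u i) = α i • u i)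
    (hv : ∀ j, B (v j) = β j • v j) (hHu : ∀ i, HA (u i) = h (α i) • u i) (hHv : ∀ j, HB (v j) = h (β j) • v j) {L : ℝ} (hL : 0 ≤ L)
    (hh : ∀ s t, |h s - h t| ≤ L * |s - t|) {δ : ℝ} (hδ : 0 ≤ δ) (hAB : ∀ z, ‖(A - B) z‖ ≤ δ * ‖z‖) (x y : E) :
    |⟪x, (HA - HB) y⟫| ≤ L * (Real.sqrt (Fintype.card κ) * δ) * ‖x‖ * ‖y‖ :=
  (abs_inner_sub_le hA hHA hu hv hHu hHv hL hh x y).trans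
    (mul_le_mul_of_nonneg_right (mul_le_mul_of_nonneg_right
      (mul_le_mul_of_nonneg_left (sqrt_sum_norm_sq_le v hδ hAB) hL) (norm_nonneg _)) (norm_nonneg _))

end Frames

end Literature.Analysis.OperatorTheory.SymmetricLipschitz

end
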